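import Summits.CriticalPhenomena.CardyFormulaZ2.Theses.CardySelfRefinement
import Summits.CriticalPhenomena.CardyFormulaZ2.Theorems.CardySelfRefinementSymmetryUpgradeROfConjecture
import Summits.CriticalPhenomena.CardyFormulaZ2.Theorems.CardySelfRefinementSymmetryUpgradeRZhouDefs
import HarnessLib

/-!
# Glued split of the crux `CardySelfRefinement.SymmetryUpgradeR` (stmt-CriticalPhenomena-17239)
# at the lattice seam "SLE₆ on corner-marked rectilinear polygons | RSW patch to all domains"

Crux-strategist decomposition (D-0019 glued split, two children, planner seat
`planner-cstrat-stmt-CriticalPhenomena-17239-s1-0`, 2026-08-17).  The crux is the identification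
half of conformal invariance for critical bond-`ℤ²` percolation once clause (iv) pins the family
(`Negative.symmetryUpgradeR_false_without_clauseIV`; landed sandwich
`symmetryUpgradeR_of_sle6LimitZ2AllDiscretisations`).  Every line on record reaches it
LATTICE-SIDE, and the only live one (`Cruxes/SymmetryUpgradeR/Lines/zhou_rotation_split_audit.lean`)
passes through exactly one internal waypoint, the `∃`-family SLE₆ statement on the Zhou class
`ZhouRotationSplitAudit.SLESixOnZhouClass` (conclusion of `stub_zhouBackEnd`, hypothesis of
`stub_allDomainsOfZhouClass`).  This file promotes that waypoint to ROUTE LEVEL: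

* child 1 `SLESixOnCornerMarkedRectilinear` — for every Dobrushin domain whose Jordan boundary is
  a finite union of axis-parallel segments and whose two marked points are convex right-angle
  corners, SOME admissible square-lattice discretisation family has exploration interfaces
  converging in law to chordal SLE₆ (W. Zhou, arXiv:2409.03235 v6, Thm 2, read on tree-admissible
  data: corner marks make his Condition C satisfiable by a `ZdDiscretisationFamily`).  VERBATIM
  `SLESixOnZhouClass` with `IsRectilinear`/`IsCornerMark` unfolded (`Iff.rfl` below), so the live
  line's `stub_halfCR ∧ stub_rotationSplit ∧ stub_halfPlaneOneArm ∧ stub_zhouBackEnd` conclude it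
  with no change, and so would any other lattice mechanism for the missing Cauchy–Riemann half
  (DCS 2012 Conj. 8.7 at `q = 1`) followed by the tree's `κ = 6` martingale layer
  (`Literature/…/ParaObservableLocalMartingale.lean`, `ParaObservableFarField.lean`).
* child 2 `RectilinearToAllDomains` — child 1 ⟹ Smirnov's Conjecture 4 at `q = 1` for EVERY
  Dobrushin domain and EVERY admissible family (the body of
  `Literature.Probability.Percolation.SLE6LimitZ2AllDiscretisations`, INLINED as in the route's
  `SubseqUpgrade`/`InterfaceToCardy` so that no open-conjecture constant enters the Theses cone):
  RSW technology not in print for bond-`ℤ²` — insensitivity to the `o(1)` placement of discrete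
  marks/arcs, Radó approximation of a Jordan domain by corner-marked rectilinear polygons, collar
  coupling at fixed mesh (half-plane three-arm exponent `2 > 1`), Carathéodory continuity of the
  SLE₆ law, Aizenman–Burchard tightness.  VERBATIM the registered `stub_allDomainsOfZhouClass`
  up to the same unfolding; same content as the sibling crux 10814's `stub_allDomainsOfRectilinear`;
  the lead's landed `allDomainsOfZhouClass_of` (p156842) already reduces it to two named inputs.
* glue `SymmetryUpgradeR_of_subs : child 1 → child 2 → SymmetryUpgradeR` — sorry-free, three lines
  over the landed sandwich; registered as a stub name of the item before landing.

Why this seam (strategist census `Cruxes/SymmetryUpgradeR/STRATEGY-CENSUS.md`): it is the one cut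
of the crux into two pieces that are (a) each genuine and independently staffable — child 2 is
`L–XL` RSW analysis with a written blueprint and a sibling twin, child 1 carries the whole open
content in its most concrete lattice form —, (b) neither a rewording of the crux (child 1 is a pure
lattice `∃`-family convergence statement on a subclass, no chordal-family axioms; child 2 an
implication between two lattice statements; the planner's probes `SLESixOnZhouClass ↛ crux`,
`↛ CardyFormulaZ2` by `exact? | simpa | aesop` are on file, probe.lean of the crux-plan seat), and
(c) already typed over REVIEWED vocabulary (`ZhouDefs`, p153813; non-vacuity of the class:
`zhouClass_nonempty` in the live skeleton §3), so no fresh analytic statement is filed as an item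
(cf. the mis-typed `CardySusyWard.ParafermionPrecompact`, stmt-11293 ≡ ¬H).  The finer seam
"uniform observable convergence on the Condition-C class | martingale identification" (Zhou Thm 1 |
§6) lives one level down, as a LINE on child 1 (two item layers only, D-0019).
-/

noncomputable section

namespace Summit.CriticalPhenomena.CardyFormulaZ2.Theorems.SymmetryUpgradeR.Split

open MeasureTheory Filter Set Metric
open Literature.Probability.RandomPlanarGeometry Literature.Probability.LatticeModels
open Literature.Probability.Percolation (BondConfig bondPercolation half)
open Summit.CriticalPhenomena.CardyFormulaZ2.Theorems.SymmetryUpgradeR.ZhouRotationSplitAudit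
  (IsRectilinear IsCornerMark SLESixOnZhouClass)

/-- **Child 1 — SLE₆ along one admissible family on every convex-corner-marked rectilinear
Dobrushin polygon** (route-level copy of `ZhouRotationSplitAudit.SLESixOnZhouClass` with
`IsRectilinear`, `IsCornerMark` unfolded; Zhou arXiv:2409.03235 v6 Thm 2 on tree-admissible data).
[cite: Zhou2024SLE6BondZ2, Theorem 2] -/
def SLESixOnCornerMarkedRectilinear : Prop :=
  ∀ D : Literature.Probability.RandomPlanarGeometry.DobrushinDomain, (∃ S : Finset (ℂ × ℂ), (∀ e ∈ S, (e.1 - e.2).re = 0 ∨ (e.1 - e.2).im = 0) ∧ frontier D.carrier = ⋃ e ∈ S, segment ℝ e.1 e.2) → (∃ (r : ℝ) (η : ℂ), 0 < r ∧ (η = 1 ∨ η = Complex.I ∨ η = -1 ∨ η = -Complex.I) ∧ D.carrier ∩ Metric.ball (D.pt 0) r = {z | z ∈ Metric.ball (D.pt 0) r ∧ 0 < ((z - D.pt 0) * (starRingEnd ℂ) η).re ∧ 0 < ((z - D.pt 0) * (starRingEnd ℂ) η).im}) → (∃ (r : ℝ) (η : ℂ), 0 < r ∧ (η = 1 ∨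 η = Complex.I ∨ η = -1 ∨ η = -Complex.I) ∧ D.carrier ∩ Metric.ball (D.pt 1) r = {z | z ∈ Metric.ball (D.pt 1) r ∧ 0 < ((z - D.pt 1) * (starRingEnd ℂ) η).re ∧ 0 < ((z - D.pt 1) * (starRingEnd ℂ) η).im}) → ∃ E : ℝ → Literature.Probability.LatticeModels.DiscreteDobrushin, Literature.Probability.LatticeModels.ZdDiscretisationFamily D E ∧ Literature.Probability.RandomPlanarGeometry.ConvergesInLawToSLE 6 D (Ωδ := fun _ => Literature.Probability.Percolation.BondConfig (Literature.Probability.LatticeModels.Site 2)) (fun δ => Literature.Probability.Percolation.bondInterfaceIn D (E δ)) (fun _ => Literature.Probability.Percolation.bondPercolation (Literature.Probability.LatticeModels.zdGraph 2) Literature.Probability.Percolation.half)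

/-- **Child 2 — the RSW patch**: child 1 implies SLE₆ convergence of the bond-`ℤ²` interface for
every Dobrushin domain and every admissible discretisation family (body of
`SLE6LimitZ2AllDiscretisations` inlined; route-level copy of the registered
`stub_allDomainsOfZhouClass`). [cite: CamiaNewman2007, §5–§7] [cite: AizenmanBurchard1999, Theorem 1.1] -/
def RectilinearToAllDomains : Prop :=
  SLESixOnCornerMarkedRectilinear → ∀ (D : Literature.Probability.RandomPlanarGeometry.DobrushinDomain) (E : ℝ → Literature.Probability.LatticeModels.DiscreteDobrushin), Literature.Probability.LatticeModels.ZdDiscretisationFamily D E → Literature.Probability.RandomPlanarGeometry.ConvergesInLawToSLE 6 D (Ωδ := fun _ => Literature.Probability.Percolation.BondConfig (Literature.Probability.LatticeModels.Site 2)) (fun δ => Literature.Probability.Percolation.bondInterfaceIn D (E δ)) (fun _ => Literature.Probability.Percolation.bondPercolation (Literature.Probability.LatticeModels.zdGraph 2) Literature.Probability.Percolation.half)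

/-! ### Identifications with the live line's vocabulary (all `Iff.rfl`) -/

/-- Child 1 is LITERALLY the live line's waypoint `SLESixOnZhouClass` (conclusion of the
registered `stub_zhouBackEnd`). [folklore] -/
theorem sleSixOnCornerMarkedRectilinear_iff :
    SLESixOnCornerMarkedRectilinear ↔ SLESixOnZhouClass :=
  Iff.rfl

/-- Child 2 is LITERALLY the registered `stub_allDomainsOfZhouClass`
(`SLESixOnZhouClass → SLE6LimitZ2AllDiscretisations`). [folklore] -/
theorem rectilinearToAllDomains_iff :
    RectilinearToAllDomains ↔
      (SLESixOnZhouClass → Literature.Probability.Percolation.SLE6LimitZ2AllDiscretisations) :=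
  Iff.rfl

/-- The conclusion of child 2 is the inlined body of Smirnov's Conjecture 4 at `q = 1`. [folklore] -/
theorem rectilinearToAllDomains_apply (h₁ : SLESixOnCornerMarkedRectilinear)
    (h₂ : RectilinearToAllDomains) :
    Literature.Probability.Percolation.SLE6LimitZ2AllDiscretisations :=
  fun D E hE => h₂ h₁ D E hE

/-! ### The glue (registered stub name `SymmetryUpgradeR_of_subs`; binders = the children's
statements written out, conclusion = the crux BY NAME) -/

/-- **GLUE of the split: child 1 → child 2 → `SymmetryUpgradeR`.**  Child 2 applied to child 1 is
Smirnov's Conjecture 4 at `q = 1` for all domains and families; the landed sandwich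
`symmetryUpgradeR_of_sle6LimitZ2AllDiscretisations` (a family pinned by clause (iv) is the weak
limit of laws converging to THE SLE₆ law) concludes.  No `sorry`. [folklore] -/
theorem SymmetryUpgradeR_of_subs :
    (∀ D : Literature.Probability.RandomPlanarGeometry.DobrushinDomain, (∃ S : Finset (ℂ × ℂ), (∀ e ∈ S, (e.1 - e.2).re = 0 ∨ (e.1 - e.2).im = 0) ∧ frontier D.carrier = ⋃ e ∈ S, segment ℝ e.1 e.2) → (∃ (r : ℝ) (η : ℂ), 0 < r ∧ (η = 1 ∨ η = Complex.I ∨ η = -1 ∨ η = -Complex.I) ∧ D.carrier ∩ Metric.ball (D.pt 0) r = {z | z ∈ Metric.ball (D.pt 0) r ∧ 0 < ((z - D.pt 0) * (starRingEnd ℂ) η).re ∧ 0 < ((z - D.pt 0) * (starRingEnd ℂ) η).im}) → (∃ (r : ℝ) (η : ℂ), 0 < r ∧ (η = 1 ∨ η = Complex.I ∨ η = -1 ∨ η = -Complex.I) ∧ D.carrier ∩ Metric.ball (D.pt 1) r = {z | z ∈ Metric.ball (D.pt 1) r ∧ 0 < ((z - D.pt 1) * (starRingEnd ℂ) η).re ∧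 0 < ((z - D.pt 1) * (starRingEnd ℂ) η).im}) → ∃ E : ℝ → Literature.Probability.LatticeModels.DiscreteDobrushin, Literature.Probability.LatticeModels.ZdDiscretisationFamily D E ∧ Literature.Probability.RandomPlanarGeometry.ConvergesInLawToSLE 6 D (Ωδ := fun _ => Literature.Probability.Percolation.BondConfig (Literature.Probability.LatticeModels.Site 2)) (fun δ => Literature.Probability.Percolation.bondInterfaceIn D (E δ)) (fun _ => Literature.Probability.Percolation.bondPercolation (Literature.Probability.LatticeModels.zdGraph 2) Literature.Probability.Percolation.half)) →
    ((∀ D : Literature.Probability.RandomPlanarGeometry.DobrushinDomain, (∃ S : Finset (ℂ × ℂ), (∀ e ∈ S, (e.1 - e.2).re = 0 ∨ (e.1 - e.2).im = 0) ∧ frontier D.carrier = ⋃ e ∈ S, segment ℝ e.1 e.2) → (∃ (r : ℝ) (η : ℂ), 0 < r ∧ (η = 1 ∨ η = Complex.I ∨ η = -1 ∨ η = -Complex.I) ∧ D.carrier ∩ Metric.ball (D.pt 0) r = {z | z ∈ Metric.ball (D.pt 0) r ∧ 0 < ((z - D.pt 0) * (starRingEnd ℂ) η).re ∧ 0 < ((z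 - D.pt 0) * (starRingEnd ℂ) η).im}) → (∃ (r : ℝ) (η : ℂ), 0 < r ∧ (η = 1 ∨ η = Complex.I ∨ η = -1 ∨ η = -Complex.I) ∧ D.carrier ∩ Metric.ball (D.pt 1) r = {z | z ∈ Metric.ball (D.pt 1) r ∧ 0 < ((z - D.pt 1) * (starRingEnd ℂ) η).re ∧ 0 < ((z - D.pt 1) * (starRingEnd ℂ) η).im}) → ∃ E : ℝ → Literature.Probability.LatticeModels.DiscreteDobrushin, Literature.Probability.LatticeModels.ZdDiscretisationFamily D E ∧ Literature.Probability.RandomPlanarGeometry.ConvergesInLawToSLE 6 D (Ωδ := fun _ => Literature.Probability.Percolation.BondConfig (Literature.Probability.LatticeModels.Site 2)) (fun δ => Literature.Probability.Percolation.bondInterfaceIn D (E δ)) (fun _ => Literature.Probability.Percolation.bondPercolation (Literature.Probability.LatticeModels.zdGraph 2) Literature.Probability.Percolation.half)) → ∀ (D : Literature.Probability.RandomPlanarGeometry.DobrushinDomain) (E : ℝ → Literature.Probability.LatticeModels.DiscreteDobrushin), Literature.Probability.LatticeModels.ZdDiscretisationFamily D E → Literature.Probability.RandomPlanarGeometry.ConvergesInLawToSLE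 6 D (Ωδ := fun _ => Literature.Probability.Percolation.BondConfig (Literature.Probability.LatticeModels.Site 2)) (fun δ => Literature.Probability.Percolation.bondInterfaceIn D (E δ)) (fun _ => Literature.Probability.Percolation.bondPercolation (Literature.Probability.LatticeModels.zdGraph 2) Literature.Probability.Percolation.half)) →
    Summit.CriticalPhenomena.CardyFormulaZ2.Theses.CardySelfRefinement.SymmetryUpgradeR :=
  fun h₁ h₂ =>
    SwallowingSkeleton.symmetryUpgradeR_of_sle6LimitZ2AllDiscretisations (fun D E hE => h₂ h₁ D E hE)

/-- The same glue over the named children. [folklore] -/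
theorem SymmetryUpgradeR_of_children (h₁ : SLESixOnCornerMarkedRectilinear)
    (h₂ : RectilinearToAllDomains) :
    Summit.CriticalPhenomena.CardyFormulaZ2.Theses.CardySelfRefinement.SymmetryUpgradeR :=
  SymmetryUpgradeR_of_subs h₁ h₂

/-- The same glue over the live line's waypoint and its registered patch stub: so the live
skeleton's `stub_zhouBackEnd` (with S1–S3) proves child 1 and `stub_allDomainsOfZhouClass` proves
child 2, verbatim. [folklore] -/
theorem SymmetryUpgradeR_of_zhouClass (h₁ : SLESixOnZhouClass)
    (h₂ : SLESixOnZhouClass → Literature.Probability.Percolation.SLE6LimitZ2AllDiscretisations) :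
    Summit.CriticalPhenomena.CardyFormulaZ2.Theses.CardySelfRefinement.SymmetryUpgradeR :=
  SymmetryUpgradeR_of_subs h₁ h₂

end Summit.CriticalPhenomena.CardyFormulaZ2.Theorems.SymmetryUpgradeR.Split

end
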